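import Mathlib

/-!
# Ladder blocks: full-size, pairwise disjoint, and the tiling case of shape packing

Block-form / extremal-structure lemmas supporting item `stmt-MatrixMultiplication-14308`
(`FourierTwoFamiliesModP.PrimeTwoFamilies`, CKSU 2005 Conj. 4.7 with prime cyclic hosts),
line `Sketch` (siege seat k18, variation "explicit / elementary route").

A LADDER in an abelian group `G` is a family of `r` classes `(X c, Y c)`, `c : Fin r`, with

* (`hW`) every class DIRECT: `(x - x') + (y - y') = 0`, `x x' ∈ X c`, `y y' ∈ Y c`, forces
  `x = x'` and `y = y'`;
* (`hL`) for classes `p < q` every cross difference `y' - x'` (`x' ∈ X p`, `y' ∈ Y q`) avoids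
  every diagonal difference `y - x` (`x ∈ X c`, `y ∈ Y c`, any class `c`).

Suppose one pattern `Y₀` has a translate `u c +ᵥ Y₀ ⊆ Y c` inside the `Y`-side of every class
`c ∈ S`, and consider the untranslated Minkowski blocks `X c + Y₀ ⊆ G`, `c ∈ S`.  The two ladder
hypotheses act separately:

1. DIRECTNESS ALONE makes every block full-size, `|X c + Y₀| = |X c| · |Y₀|`
   (`direct_of_vadd_subset`, `card_add_of_direct`): directness of `(X c, Y c)` passes to the
   translated sub-pattern `(X c, Y₀)`, and directness of a pair is exactly injectivity of addition
   on it.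
2. THE LADDER ORDER ALONE makes distinct blocks disjoint (`pairwiseDisjoint_blocks`): a coincidence
   `a + b = a' + b'` across blocks `i ≠ k` (`a ∈ X i`, `a' ∈ X k`, `b b' ∈ Y₀`) reads
   `(u_k + b) - a' = (u_k + b') - a` — a diagonal difference of class `k` equal to a cross
   difference between `X i` and `Y k`, excluded by `hL` at `(k, i, k)` when `i < k` — and
   symmetrically `(u_i + b') - a = (u_i + b) - a'` is excluded by `hL` at `(i, k, i)` when `k < i`.

Hence the EXACT count `|⋃_{c ∈ S} (X c + Y₀)| = (Σ_{c ∈ S} |X c|) · |Y₀|` (`card_biUnion_blocks`);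
with `Finset.card_le_univ` this recovers the shape packing bound
`(Σ_{c ∈ S} |X c|) · |Y₀| ≤ |G|` of the tree
(`LadderLift.ladder_sum_card_mul_card_le_of_subshape`, file
`FourierTwoFamiliesModPPrimeTwoFamiliesLadderShapes`, which runs one injection on a sigma type), and
it identifies the extremal configurations: the bound is attained iff the blocks TILE `G`
(`sum_card_mul_card_eq_card_iff_blocks_tile`) — a near-apex ladder level with a common `Y`-template
is a near-tiling of the host by the translates `x + Y₀`, `x ∈ ⋃ X c`.
[folklore; one-directional analogue of the SDPP packing `sum_card_mul_card_le_of_subshape` of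
`Theorems/PrimeTwoFamilies/Negative/Shapes.lean`]
-/

-- single-conjunct summit: the mandated namespace repeats `MatrixMultiplication` (summit = sub-problem).
set_option linter.dupNamespace false

namespace Summit.MatrixMultiplication.MatrixMultiplication.Theorems.PrimeTwoFamilies.LadderBlocks

open Finset
open scoped Pointwise

/-- **Directness passes to translated sub-patterns.**  If `(Xc, Yc)` is direct and
`u +ᵥ Y₀ ⊆ Yc`, then `(Xc, Y₀)` is direct: `(x - x') + (y - y') = (x - x') + ((u + y) - (u + y'))`.
[folklore] -/
theorem direct_of_vadd_subset {G : Type*} [AddCommGroup G] [DecidableEq G] (Xc Yc Y₀ : Finset G)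
    (u : G) (hW : ∀ x ∈ Xc, ∀ x' ∈ Xc, ∀ y ∈ Yc, ∀ y' ∈ Yc, (x - x') + (y - y') = 0 → x = x' ∧ y = y')
    (hY : u +ᵥ Y₀ ⊆ Yc) :
    ∀ x ∈ Xc, ∀ x' ∈ Xc, ∀ y ∈ Y₀, ∀ y' ∈ Y₀, (x - x') + (y - y') = 0 → x = x' ∧ y = y' := by
  have memY : ∀ b ∈ Y₀, u + b ∈ Yc := fun b hb => hY (Finset.mem_vadd_finset.2 ⟨b, hb, rfl⟩)
  intro x hx x' hx' y hy y' hy' e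
  obtain ⟨h1, h2⟩ := hW x hx x' hx' _ (memY y hy) _ (memY y' hy')
    (by rw [add_sub_add_left_eq_sub, e])
  exact ⟨h1, add_left_cancel h2⟩

/-- **A direct pair spans a full-size block**: if `(Xc, Y₀)` is direct then addition is injective on
`Xc ×ˢ Y₀`, so `|Xc + Y₀| = |Xc| · |Y₀|`. [folklore] -/
theorem card_add_of_direct {G : Type*} [AddCommGroup G] [DecidableEq G] (Xc Y₀ : Finset G)
    (hW : ∀ x ∈ Xc, ∀ x' ∈ Xc, ∀ y ∈ Y₀, ∀ y' ∈ Y₀, (x - x') + (y - y') = 0 → x = x' ∧ y = y') :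
    (Xc + Y₀).card = Xc.card * Y₀.card := by
  refine Finset.card_add_iff.2 ?_
  rintro ⟨a, b⟩ hab ⟨a', b'⟩ hab' (e : a + b = a' + b')
  simp only [Set.mem_prod, Finset.mem_coe] at hab hab'
  obtain ⟨h1, h2⟩ := hW a hab.1 a' hab'.1 b hab.2 b' hab'.2 (by rw [sub_add_sub_comm, e, sub_self])
  rw [h1, h2]

/-- **The ladder order separates the blocks.**  If cross differences between a lower `X`-class and
a higher `Y`-class avoid all diagonal differences (`hL`) and `u c +ᵥ Y₀ ⊆ Y c` for `c ∈ S`, then the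
blocks `X c + Y₀`, `c ∈ S`, are pairwise disjoint: a common element `a + b = a' + b'`
(`a ∈ X i`, `a' ∈ X k`, `b b' ∈ Y₀`) gives `(u_k + b) - a' = (u_k + b') - a`, impossible for
`i < k`, and `(u_i + b') - a = (u_i + b) - a'`, impossible for `k < i`.  Directness is not used.
[folklore] -/
theorem pairwiseDisjoint_blocks {G : Type*} [AddCommGroup G] [DecidableEq G] {r : ℕ}
    (X Y : Fin r → Finset G)
    (hL : ∀ c p q : Fin r, p < q → ∀ x ∈ X c, ∀ y ∈ Y c, ∀ x' ∈ X p, ∀ y' ∈ Y q, y - x ≠ y' - x')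
    (S : Finset (Fin r)) (Y₀ : Finset G) (u : Fin r → G) (hY : ∀ c ∈ S, u c +ᵥ Y₀ ⊆ Y c) :
    (S : Set (Fin r)).PairwiseDisjoint fun c => X c + Y₀ := by
  have memY : ∀ c ∈ S, ∀ b ∈ Y₀, u c + b ∈ Y c := fun c hc b hb =>
    hY c hc (Finset.mem_vadd_finset.2 ⟨b, hb, rfl⟩)
  intro i hi k hk hik
  refine Finset.disjoint_left.2 fun g hgi hgk => ?_
  rw [Finset.mem_add] at hgi hgk
  obtain ⟨a, ha, b, hb, rfl⟩ := hgi
  obtain ⟨a', ha', b', hb', e⟩ := hgk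
  -- `e : a' + b' = a + b`; the coincidence as an equality of differences, translated by any `v`
  have d₀ : b - a' = b' - a :=
    sub_eq_sub_iff_add_eq_add.2 ((add_comm b a).trans (e.symm.trans (add_comm a' b')))
  have d : ∀ v : G, (v + b) - a' = (v + b') - a := fun v => by
    rw [add_sub_assoc, add_sub_assoc, d₀]
  rcases lt_or_gt_of_ne hik with hik | hki
  · -- `i < k`: diagonal difference `(u k + b) - a'` of class `k` = cross difference `(u k + b') - a`
    exact hL k i k hik a' ha' _ (memY k hk b hb) a ha _ (memY k hk b' hb') (d (u k))
  · -- `k < i`: diagonal difference `(u i + b') - a` of class `i` = cross difference `(u i + b) - a'`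
    exact hL i k i hki a ha _ (memY i hi b' hb') a' ha' _ (memY i hi b hb) (d (u i)).symm

/-- **Exact block count.**  For a ladder with a common translated sub-pattern `Y₀` of the `Y`-sides
over `S`, the blocks `X c + Y₀`, `c ∈ S`, are pairwise disjoint and full-size, so their union has
exactly `(Σ_{c ∈ S} |X c|) · |Y₀|` elements.  (With `Finset.card_le_univ` this is the shape
packing bound `LadderLift.ladder_sum_card_mul_card_le_of_subshape`.) [folklore] -/
theorem card_biUnion_blocks {G : Type*} [AddCommGroup G] [DecidableEq G] {r : ℕ}
    (X Y : Fin r → Finset G)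
    (hW : ∀ c : Fin r, ∀ x ∈ X c, ∀ x' ∈ X c, ∀ y ∈ Y c, ∀ y' ∈ Y c,
      (x - x') + (y - y') = 0 → x = x' ∧ y = y')
    (hL : ∀ c p q : Fin r, p < q → ∀ x ∈ X c, ∀ y ∈ Y c, ∀ x' ∈ X p, ∀ y' ∈ Y q, y - x ≠ y' - x')
    (S : Finset (Fin r)) (Y₀ : Finset G) (u : Fin r → G) (hY : ∀ c ∈ S, u c +ᵥ Y₀ ⊆ Y c) :
    (S.biUnion fun c => X c + Y₀).card = (∑ c ∈ S, (X c).card) * Y₀.card := by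
  rw [Finset.card_biUnion (pairwiseDisjoint_blocks X Y hL S Y₀ u hY), Finset.sum_mul]
  exact Finset.sum_congr rfl fun c hc =>
    card_add_of_direct (X c) Y₀ (direct_of_vadd_subset (X c) (Y c) Y₀ (u c) (hW c) (hY c hc))

/-- **Extremal structure of shape packing.**  Equality in the shape packing bound holds exactly
when the blocks `X c + Y₀`, `c ∈ S`, TILE the group:
`(Σ_{c ∈ S} |X c|) · |Y₀| = |G| ↔ ⋃_{c ∈ S} (X c + Y₀) = G`. [folklore] -/
theorem sum_card_mul_card_eq_card_iff_blocks_tile {G : Type*} [AddCommGroup G] [Fintype G]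
    [DecidableEq G] {r : ℕ} (X Y : Fin r → Finset G)
    (hW : ∀ c : Fin r, ∀ x ∈ X c, ∀ x' ∈ X c, ∀ y ∈ Y c, ∀ y' ∈ Y c,
      (x - x') + (y - y') = 0 → x = x' ∧ y = y')
    (hL : ∀ c p q : Fin r, p < q → ∀ x ∈ X c, ∀ y ∈ Y c, ∀ x' ∈ X p, ∀ y' ∈ Y q, y - x ≠ y' - x')
    (S : Finset (Fin r)) (Y₀ : Finset G) (u : Fin r → G) (hY : ∀ c ∈ S, u c +ᵥ Y₀ ⊆ Y c) :
    (∑ c ∈ S, (X c).card) * Y₀.card = Fintype.card G ↔ (S.biUnion fun c => X c + Y₀) = univ := by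
  rw [← card_biUnion_blocks X Y hW hL S Y₀ u hY, Finset.card_eq_iff_eq_univ]

end Summit.MatrixMultiplication.MatrixMultiplication.Theorems.PrimeTwoFamilies.LadderBlocks
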